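import Summits.FinalStateConjecture.FinalStateConjecture.Theses.ExactKerrEnds
import Summits.FinalStateConjecture.FinalStateConjecture.Theorems.ExactKerrEndsSettlingAlongCensoredKerrEndsFromSummit

/-!
# Equivalence audit probes — crux `SettlingAlongCensoredKerrEnds` (stmt-FinalStateConjecture-18520)
# planner-cstrat-stmt-FinalStateConjecture-18520-q1 (suspect: equivalence), 2026-08-17

The gate record `summit_equivalent` (theorem
`Theorems.ExactKerrEnds.settlingAlongCensoredKerrEnds_iff_finalStateConjecture`, direction iff) is
CONDITIONAL on the route's other items `TameEscapeToKerrEnds` (E, stmt-18522),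
`CensorshipAlongKerrEnds` (C₁, stmt-18521) and `MGHDExists` (M, stmt-9937) — all OPEN.
This file kernel-checks the shape of that equivalence:

* `P1`–`P6`: the standard battery `exact? | simpa | aesop (terminal)` (400 k heartbeats) closes NONE of
  `C₂ → S`, `(all binders of closes except C₂) → S`, `C₁ → S`, `E → S`, `M → S`, `E → C₁ → M → C₂`
  (each wrapped in `fail_if_success`, then `sorry`: the file elaborates iff every battery FAILS);
* `C1`, `C2`: controls — the E-level assembly `E → C₁ → C₂ → M → S` and the unconditional
  `S → C₂` are landed theorems (found by `exact?` in the companion run `equiv_probes.lean`, rc 1 by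
  design, 18 s, errors = exactly the six "unsolved goals" of P1–P6).

Reading: C₂ is a CONSEQUENCE of S (C2) that is LOAD-BEARING in `closes` (P2) and not implied by its
siblings (P6); no single piece of the decomposition gives S (P1, P3–P5). The equivalence "C₂ ↔ S given
E ∧ C₁ ∧ M" is therefore the forced shape of a complete decomposition whose remaining pieces are open
and substantive (C₁ = weak cosmic censorship in the Kerr-ended class), not a restatement.
-/

open Summit.FinalStateConjecture.FinalStateConjecture.Theses.ExactKerrEnds

namespace Summit.FinalStateConjecture.FinalStateConjecture.Cruxes.SettlingAlongCensoredKerrEnds.EquivalenceProbesQ1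

-- P1: C₂ alone ⟹ S — battery FAILS
set_option maxHeartbeats 400000 in
example : SettlingAlongCensoredKerrEnds → FinalStateConjecture := by
  fail_if_success (first | exact? | (intro h; simpa using h) | aesop (config := { terminal := true }))
  sorry

-- P2: every binder of `closes` EXCEPT C₂ ⟹ S — battery FAILS (C₂ is load-bearing)
set_option maxHeartbeats 400000 in
example : TameEscapeGivenMassTheorems → AdmissibleMassNonneg → ZeroMassAdmissibleMinkowskian →
    CensorshipAlongKerrEnds → MGHDExists → FinalStateConjecture := by
  fail_if_success (first | exact? | aesop (config := { terminal := true }))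
  sorry

-- P3: C₁ alone ⟹ S — battery FAILS
set_option maxHeartbeats 400000 in
example : CensorshipAlongKerrEnds → FinalStateConjecture := by
  fail_if_success (first | exact? | (intro h; simpa using h) | aesop (config := { terminal := true }))
  sorry

-- P4: E alone ⟹ S — battery FAILS
set_option maxHeartbeats 400000 in
example : TameEscapeToKerrEnds → FinalStateConjecture := by
  fail_if_success (first | exact? | (intro h; simpa using h) | aesop (config := { terminal := true }))
  sorry

-- P5: M alone ⟹ S — battery FAILS
set_option maxHeartbeats 400000 in
example : MGHDExists → FinalStateConjecture := by
  fail_if_success (first | exact? | (intro h; simpa using h) | aesop (config := { terminal := true }))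
  sorry

-- P6: E ∧ C₁ ∧ M ⟹ C₂ — battery FAILS (C₂ is not implied by its siblings)
set_option maxHeartbeats 400000 in
example : TameEscapeToKerrEnds → CensorshipAlongKerrEnds → MGHDExists →
    SettlingAlongCensoredKerrEnds := by
  fail_if_success (first | exact? | aesop (config := { terminal := true }))
  sorry

-- C1 (control): the E-level assembly is landed
example : TameEscapeToKerrEnds → CensorshipAlongKerrEnds → SettlingAlongCensoredKerrEnds → MGHDExists →
    FinalStateConjecture :=
  Summit.FinalStateConjecture.FinalStateConjecture.Theorems.ExactKerrEnds.finalStateConjecture_of_tameEscape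

-- C2 (control): the summit implies the crux, unconditionally (landed)
example : FinalStateConjecture → SettlingAlongCensoredKerrEnds :=
  Summit.FinalStateConjecture.FinalStateConjecture.Theorems.ExactKerrEnds.settlingAlongCensoredKerrEnds_of_finalStateConjecture

-- C3 (control): the recorded witness itself — the iff over the three open siblings
example (hE : TameEscapeToKerrEnds) (hC : CensorshipAlongKerrEnds) (hM : MGHDExists) :
    SettlingAlongCensoredKerrEnds ↔ FinalStateConjecture :=
  Summit.FinalStateConjecture.FinalStateConjecture.Theorems.ExactKerrEnds.settlingAlongCensoredKerrEnds_iff_finalStateConjecture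
    hE hC hM

end Summit.FinalStateConjecture.FinalStateConjecture.Cruxes.SettlingAlongCensoredKerrEnds.EquivalenceProbesQ1
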